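import Literature.Algebra.EuclideanLattices.BabaiResidual
import HarnessLib

/-!
# Babai's residual certifies farness from the lattice (the NO-side certificate of a good basis)

Topic `Algebra/EuclideanLattices`, namespace `Babai` (continuation of `BabaiNearestPlane.lean` /
`BabaiResidual.lean`: the exact-recovery guarantee `Babai.nearestPlane_vecOf_add_of_norm_lt` and the
residual `Babai.residual k f t = t − ∑ (nearestPlane f t)ᵢ bᵢ` are the only ingredients).  For a
basis `f = (b₀,…,b_{k-1})` all of whose Gram–Schmidt vectors are long, `‖b̃ᵢ‖ ≥ 2R`, Babai's
nearest-plane algorithm returns THE lattice vector within distance `< R` of the target whenever one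
exists (`Babai.vecOf_nearestPlane_eq_of_norm_sub_lt`); consequently a LARGE residual,
`‖residual_f(t)‖ = ‖t − Babai_f(t)‖ ≥ R`, certifies that every vector of `L(f) = span_ℤ f` is at distance `≥ R` from `t`
(`Babai.le_norm_sub_of_le_residual`, `Babai.le_infDist_of_le_residual`), and the residual test is
exact: `‖t − Babai_f(t)‖ ≥ R ↔ dist(t, L(f)) ≥ R` (`Babai.le_residual_iff`).  This is how a party
holding a good (trapdoor) basis certifies "far from the lattice" — e.g. to sample NO instances of a
gap/bounded-distance problem with support EXACTLY on the promise (first user: `Summits/PneNP`, route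
`SzkEntropy`, crux `PeaWorstToAvg`, card `lattice-import-trapdoor-support`, second lemma).
All statements proved; no named facts.

## References

* L. Babai, *On Lovász' lattice reduction and the nearest lattice point problem*, Combinatorica 6
  (1986) 1–13, §3 [Babai1986].
* D. Micciancio, C. Peikert, *Trapdoors for lattices: simpler, tighter, faster, smaller*,
  EUROCRYPT 2012, §2.3–§2.4 (decoding / inversion with a good basis up to half the Gram–Schmidt
  minimum). [folklore]
-/

noncomputable section

namespace Literature.Algebra.EuclideanLattices

namespace Babai

open Finset InnerProductSpace Real GPVSampler
open scoped RealInnerProductSpace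

variable {V : Type*} [NormedAddCommGroup V] [InnerProductSpace ℝ V]

/-- **Exact recovery of a close lattice vector with a good basis.** If every Gram–Schmidt vector of
`f` has norm `≥ 2R` and the lattice vector `v ∈ L(f)` is within distance `< R` of the target `t`, then
Babai's nearest-plane algorithm on `t` returns `v`. [cite: Babai1986, §3] -/
theorem vecOf_nearestPlane_eq_of_norm_sub_lt {k : ℕ} (f : Fin k → V) {R : ℝ}
    (hgs : ∀ i, 2 * R ≤ ‖gramSchmidt ℝ f i‖) {t v : V} (hv : v ∈ Submodule.span ℤ (Set.range f))
    (hd : ‖t - v‖ < R) : vecOf f (nearestPlane k f t) = v := by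
  obtain ⟨a, rfl⟩ := vecOf_surjective_span f hv
  have hR : 0 < R := lt_of_le_of_lt (norm_nonneg _) hd
  have hf : ∀ i, gramSchmidt ℝ f i ≠ 0 := fun i =>
    norm_pos_iff.1 (lt_of_lt_of_le (by linarith) (hgs i))
  have he : ∀ i, ‖t - vecOf f a‖ < ‖gramSchmidt ℝ f i‖ / 2 := fun i => by linarith [hgs i]
  have h := nearestPlane_vecOf_add_of_norm_lt f hf a (t - vecOf f a) he
  rw [add_sub_cancel] at h
  rw [h]

/-- **Babai's residual certifies farness (NO-side certificate).** With a basis whose Gram–Schmidt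
norms are all `≥ 2R`, if the residual of Babai's algorithm on `t` has norm `≥ R` then EVERY lattice
vector is at distance `≥ R` from `t`. [cite: Babai1986, §3] -/
theorem le_norm_sub_of_le_residual {k : ℕ} (f : Fin k → V) {R : ℝ}
    (hgs : ∀ i, 2 * R ≤ ‖gramSchmidt ℝ f i‖) {t : V}
    (hcert : R ≤ ‖residual k f t‖) :
    ∀ v ∈ Submodule.span ℤ (Set.range f), R ≤ ‖t - v‖ := by
  intro v hv
  by_contra h
  have h' : ‖t - v‖ < R := lt_of_not_ge h
  rw [residual_def, vecOf_nearestPlane_eq_of_norm_sub_lt f hgs hv h'] at hcert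
  exact h hcert

/-- **The residual test is exact**: with Gram–Schmidt norms `≥ 2R`, the residual is `≥ R` iff every
lattice vector is at distance `≥ R` from the target (the residual is itself the distance to the
lattice vector `vecOf f (nearestPlane f t)`, `vecOf_mem_span`). [cite: Babai1986, §3] -/
theorem le_residual_iff {k : ℕ} (f : Fin k → V) {R : ℝ} (hgs : ∀ i, 2 * R ≤ ‖gramSchmidt ℝ f i‖)
    (t : V) :
    R ≤ ‖residual k f t‖ ↔ ∀ v ∈ Submodule.span ℤ (Set.range f), R ≤ ‖t - v‖ :=
  ⟨le_norm_sub_of_le_residual f hgs, fun h => h _ (vecOf_mem_span f _)⟩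

/-- The certificate in terms of the distance to the lattice: a residual `≥ R` gives
`dist(t, L(f)) ≥ R` (`Metric.infDist`). [cite: Babai1986, §3] -/
theorem le_infDist_of_le_residual {k : ℕ} (f : Fin k → V) {R : ℝ}
    (hgs : ∀ i, 2 * R ≤ ‖gramSchmidt ℝ f i‖) {t : V}
    (hcert : R ≤ ‖residual k f t‖) :
    R ≤ Metric.infDist t (Submodule.span ℤ (Set.range f) : Set V) :=
  (Metric.le_infDist ⟨0, Submodule.zero_mem _⟩).2 fun v hv => by
    rw [dist_eq_norm]
    exact le_norm_sub_of_le_residual f hgs hcert v hv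

/-- Conversely a small residual exhibits a close lattice vector: `dist(t, L(f)) ≤ ‖t − Babai_f(t)‖`
(no hypothesis on the basis). [cite: Babai1986, §3] -/
theorem infDist_le_residual {k : ℕ} (f : Fin k → V) (t : V) :
    Metric.infDist t (Submodule.span ℤ (Set.range f) : Set V) ≤ ‖residual k f t‖ := by
  rw [residual_def, ← dist_eq_norm]
  exact Metric.infDist_le_dist_of_mem (vecOf_mem_span f _)

end Babai

end Literature.Algebra.EuclideanLattices
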